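import Summits.QuantumFields.YangMills.Theorems.BalabanUVNodesRateReadingOfRecord13CoPH
import Summits.QuantumFields.YangMills.Theorems.BalabanUVNodesN18AtRateRecord13CoPH
import Summits.QuantumFields.YangMills.Theorems.BalabanUVNodesN18AtReadingOfRecord13

/-!
# `CoPH` EDITION of this seat's `CoPR` module `BalabanUVNodesN18AtReadingOfRecord13CoPR`: its image under def-T's token legend for the `CoPH` record (dag-lead WORDS key map of record) — binder
# `Stage13RParams ↦ Stage13HParams`, `Provisos₁₃CoPR ↦ Provisos₁₃CoPH`, guard `ZrUnity ↦ ZhUnity`, names `CoPR ↦ CoPH` (def-T record file p537939, RR-2 key leaf `Node00/Record13DatumKeyCoPH` p539151,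
# dag-n22-e `…13CoPH…` homes); the θ-level ‴ objects stay cited at `….toStage13Params` (parent projections through `extends`).  WHY: director-ym №183 ∕ №185 (FINDING №9 = def-T LOCATED-9 «HISTORY-BLIND residual 𝐓-weight slot: v1.6 `Zr p` is run-indexed but history-blind; print's ζ(Ω^c_{k+1}) [III] p.267 L15–20 ∕ (3.23) p.270 is built from the term's history»; ruling H1ʰ: `structure Stage13HParams extends Stage13RParams` + ONE history-indexed field `Zh`, guard `ZhUnity`, rows `zhLaws ∕ zhLocal`, MAXIMALITY RIDER; one edition, one press, «pens port their OWN files»).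
# Statements = the `CoPR` statements under the map, proofs verbatim; the `CoPR` module STANDS as a landed sibling.  Its header follows, token-mapped.
#
# `CoPR` (RECORD 13 v1.6, FINDING №8) EDITION of `BalabanUVNodesN18AtReadingOfRecord13` (p497335) — seat pub-ymgap-dag-n18-d (N18 = NE5, strategy s2), RE-KEYED on the run-indexed parameter record
# `Stage13RParams` ∕ the proviso binder `Stage13RParams.Provisos₁₃CoPH` ∕ the datum `Node00.datumOfRecord₁₃CoPH` (def-T's FILE 25 `Node00/Record13CoPH`, p529474), RR-2's datum key
# `Node00.IsDatumOfRecord₁₃CCoPH` (`Node00/Record13DatumKeyCoPH`, p531309) and dag-n22-e's (T-RATE) layer-B homes (`RateReading₁₃CoPH`, `RRec₁₃CoPH`, `RRec₁₃CoPHOn`, `readingOfRecord₁₃CoPH`,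
# `s_N18_rRec₁₃CoPH(On)_iff`, `forall_datumKey₁₃CoPH_of_forall_admissible`, `readingOfRecord₁₃CoPH_u3`)
#
# WHY (route `route-QuantumFields-BalabanUVNodes`; dag-lead KEY MAP of record WORDS-142): director-ym №169 (H1, TREE-FIRST) ∕ №174 (PRESS WORD) on def-T's LOCATED-8 = FINDING №8 («the residual 𝐓-weight
# slot `Stage12Params.Zt : (K : ℕ) → TkResidualW … K` is RUN-BLIND; print's ζ(Ω₁ᶜ) [III] (1.11) p.248, (2.4) p.255, (3.16)–(3.20) pp.268–9 reads the RUN»): def-T's FILE 25 `Node00/Record13CoPH` (p529474)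
# introduced `structure Stage13RParams extends Stage13Params` with ONE new run-indexed field `Zr : (p : B12.RunParams) → TkResidualW …`, the guard `ZrUnity`, the proviso core
# `Stage13RParams.Provisos₁₃CoPH` (v1.2's `Provisos₁₃Core` rows at `θ.toStage13Params` + `zrLaws ∕ zrLocal`), the datum `datumOfRecord₁₃CoPH` and the record class `IsRecordOfRecord₁₃CCoPH`
# (+ the one-way run-blind embedding `Stage13RParams.ofRunBlind` of v1.5); RR-2 re-keyed the datum key on it (`Node00/Record13DatumKeyCoPH`, p531309), the (T-RATE) layer B re-keyed its
# homes (dag-n22-e, `…13CoPH…`), plan presses rev 22 (⁶ = T₆(⁵), K3⁶ `SpineGivenEndpointR13SepCoPR`).  A theorem binding `θ : Stage13Params` cannot be applied at a `Stage13RParams` item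
# tuple's datum, so every storey typed `∀ (θ : Stage13Params F N) (hc : θ.Provisos₁₃Core F N), …` is re-keyed ONCE MORE («pens port their OWN files», №174 (3)); the ‴ ∕ `Sep` ∕ `Co` ∕
# `CoP` editions of this module STAND as landed siblings.  THIS FILE is the image of this seat's v1.5 module `BalabanUVNodesN18AtReadingOfRecord13CoP` (p526819) under def-T's KEY-RULE-25 (= WORDS-142
# legend), token for token: binder `Stage13Params ↦ Stage13RParams` (regimes `Rg`, reading families `W ∕ S ∕ sp ∕ big ∕ gauge ∕ T₀ ∕ li ∕ 𝔇 …` typed over `Stage13RParams`) ·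
# `Provisos₁₃Core ↦ Provisos₁₃CoPH` · names `CoP ↦ CoPR` (`IsDatumOfRecord₁₃CCoP ↦ IsDatumOfRecord₁₃CCoPH`, `RateReading₁₃CoP ↦ RateReading₁₃CoPH`, `RRec₁₃CoP(On) ↦ RRec₁₃CoPH(On)`,
# `readingOfRecord₁₃CoP ↦ readingOfRecord₁₃CoPH`, `forall_datumKey₁₃CoP_… ↦ forall_datumKey₁₃CoPH_…`, this seat's `rRec₁₃CoP… ↦ rRec₁₃CoPH…`, modules `…13CoP… ↦ …13CoPH…`) · SITE-RULE
# (KEY-RULE-25: `X … θ ↦ X … θ.toStage13Params` for every θ-level X NOT re-issued): `u3OfRecord₁₃ θ ↦ u3OfRecord₁₃ θ.toStage13Params` (also at `h.params`), the ‴ per-tuple junctions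
# `n18At_u3OfRecord₁₃_… θ k ↦ … θ.toStage13Params k`, `θ.toStage12Params ↦ θ.toStage13Params.toStage12Params`; `θ.γ ∕ θ.τ9.M ∕ θ.Admissible F N ∕ θ.SlotsNondegenerate₁₃ F N` resolve
# through `extends` unchanged.  Statements = the v1.5 statements under the map, proofs = the v1.5 proofs verbatim.  In the retained v1.5 paragraph below the historical token
# table reads, after the map, `Provisos₁₃ ↦ Provisos₁₃CoPH` ·
# `datumOfRecord₁₃ ↦ datumOfRecord₁₃CoPH` · `IsDatumOfRecord₁₃C ↦ IsDatumOfRecord₁₃CCoPH` · `RateReading₁₃ ↦ RateReading₁₃CoPH` · `RRec₁₃ ↦ RRec₁₃CoPH` · `RRec₁₃On ↦ RRec₁₃CoPHOn` ·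
# `readingOfRecord₁₃ ↦ readingOfRecord₁₃CoPH` · `s_N18_rRec₁₃(On)_iff ↦ s_N18_rRec₁₃CoPH(On)_iff` · `forall_datumKey₁₃_of_forall_admissible ↦ forall_datumKey₁₃CoPH_of_forall_admissible`, and in
# THIS seat's decl names `rRec₁₃ ↦ rRec₁₃CoPH`, `readingOfRecord₁₃ ↦ readingOfRecord₁₃CoPH`; statements = the ‴ statements under the map, proofs = the ‴ proofs VERBATIM.
# EVERYTHING θ-LEVEL IS UNCHANGED AND NOT RE-DECLARED (`Stage13Params`, `u3OfRecord₁₃`, the per-tuple faces and junctions of the original carry no proviso ∕ key and are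
# IMPORTED BY NAME — this module imports its ‴ original) — here: none (every decl of the original is keyed).
# ITEM IDS quoted in the ‴ header below (K3‴ `SpineGivenEndpointR13`, stmt-QuantumFields-19912; K0‴) are ASIDES; this file is filed as a HELPER on the K3 item of the
# dag-lead KEY MAP of record — COUNT-NEUTRAL, no stub closed, N18 NOT discharged, no inhabitant of any key claimed (K0 OPEN).
#
# ‴ HEADER OF RECORD FOLLOWS (token-mapped; its decl list is this file's, the θ-only names above excepted):
#
# BalabanUVNodes ∕ node N18 = NE5 — N18 AT THE REGIME-RESTRICTED STAGE-13 HOME `RRec₁₃CoPHOn 𝔯 Rg` AND AT THE (T-RATE) READING OF RECORD `readingOfRecord₁₃CoPH`: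
# closed forms and the junction row asked only of the tuples in the regime
# (Track A, DAG node N18 = `T4OutputRate.NE5` :211; cluster K4 «SpineRates», item K3‴ `SpineGivenEndpointR13`; module 18b of seat pub-ymgap-dag-n18-d, strategy s2)

HONEST FRAMING.  Count-neutral kernel bookkeeping (`--supports … --as helper`), composition BY NAME of landed theorems; NE5 is NOT PRINTED and NOT proved;
N18 is NOT discharged; no inhabitant of `IsDatumOfRecord₁₃CCoPH` is claimed (K0‴ `Record13Inhabited`, OPEN); the towers inside the reading data are residual DATA.

WHY.  Module 18 (`…N18AtRateRecord13`) typed N18's side of the Stage-13 home `RRec₁₃CoPH 𝔯` for any reading pinned to W1 reading data.  Two homes of record remain: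
(a) the REGIME-RESTRICTED home `RRec₁₃CoPHOn 𝔯 Rg` of layer B (`…RateCarriersOfRecord13On`: the bundles pinned at the datum `datumOfRecord₁₃CoPH F N θ hP` of every admissible
tuple `θ` with provisos IN THE REGIME `Rg F θ` — rev 16's guarded binder prefix `(θ.ZhUnity F 2 ∧ θ.SlotsNondegenerate₁₃ F 2) → θ.Admissible F 2 → …`, θ-form
`s_N18_rRec₁₃CoPHOn_iff`), and (b) the (T-RATE) pen's READING OF RECORD `readingOfRecord₁₃CoPH w1 ℓ₃ ne2 ne1` (`…RateReadingOfRecord13`: node U3's objects := W1's reading data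
`w1 F θ` at window radius `θ.γ`, pin `readingOfRecord₁₃CoPH_u3` by `rfl`) — the reading the K3‴ composer tables field by field (dag-n27-c).  THIS FILE: (§1) for any pinned
reading, N18 at the regime home in closed form and THE JUNCTION ROW ASKED ONLY OF THE TUPLES IN THE REGIME (module 18 §1's per-tuple junction
`n18At_u3OfRecord₁₃_readingAdm_of_envelope_bound238` under the guard); (§2) at the reading of record the pin is `rfl`: N18's statement there in W1's currency, at the
regime home, and — for the ADMISSIBLE reading family as `w1` — with the run-B fields read inside the tables; the rows at the reading of record are module 18 §3 ∕ §1
here at `hpin := readingOfRecord₁₃CoPH_u3 w1 ℓ₃ ne2 ne1` (one line, not restated).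

WHAT (all `theorem`, 0 `def`).
* §1 ★ `s_N18_rRec₁₃CoPHOn_iff_of_pin` (regime home, closed form, any pinned reading), ★ `s_N18_rRec₁₃CoPHOn_readingAdm_of_envelope_bound238_pin` (the row at the regime home:
  END data + the towers' H-layer data on the tables at the admissible tuples IN THE REGIME ⇒ `S_N18 (RRec₁₃CoPHOn 𝔯 Rg)`).
* §2 ★ `s_N18_readingOfRecord₁₃CoPH_iff_w1` (N18's statement at the reading of record, W1 currency), `s_N18_readingOfRecord₁₃CoPHOn_iff_w1` (regime home),
  ★ `s_N18_readingOfRecord₁₃CoPH_readingAdm_iff` (at the admissible reading family: admissible run-B fields, `T₀`, `pairOfRecord`).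

One finite four-torus programme at fixed `ε`; NOT the continuum limit, NOT OS, NOT a mass gap, NOT Clay.  0 `def`, 0 `sorry`.  Sources (TYPES only): T. Bałaban,
CMP **109** (1987) [Balaban1987RG1] (0.24)–(0.25) p. 257, Thm 1 p. 259, (1.11)–(1.16) p. 262, (1.18) p. 263; CMP **116** (1988) [Balaban1988RG2Cluster] (2.13) p. 14,
(2.16)–(2.18) p. 16, Lemma 3 (2.38) p. 20; CMP **122** (1989) [Balaban1989LargeFieldII] (the record's stage).
-/

noncomputable section

open Set Metric
open scoped Matrix.Norms.L2Operator

namespace YMDAG.N18.W1Reading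

open Literature.MathematicalPhysics.QuantumFieldTheory.Balaban1983to89
open Literature.MathematicalPhysics.QuantumFieldTheory.Balaban1983to89.T4Continuum
open Literature.MathematicalPhysics.QuantumFieldTheory.Balaban1983to89.T4OutputRate (Carriers Functional NE5 DecayBound Window)
open Literature.MathematicalPhysics.QuantumFieldTheory.Balaban1983to89.T4InputCauchyRateData (StepModel)
open Literature.MathematicalPhysics.QuantumFieldTheory.Balaban1983to89.B13Resummation (locE)
open Literature.MathematicalPhysics.QuantumFieldTheory.Balaban1983to89.TreeLengthTorus (TDom tsys torusTreeLen)
open Literature.MathematicalPhysics.QuantumFieldTheory.Balaban1983to89.TreeLengthTorusGeometry (TTouch)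
open Literature.MathematicalPhysics.QuantumFieldTheory.Balaban1983to89.B12TreeDecay (K₀)
open Literature.MathematicalPhysics.QuantumFieldTheory.Balaban1983to89.Node00 (Stage12Params Stage13Params Stage13RParams Stage13HParams IsDatumOfRecord₁₃CCoPH datumOfRecord₁₃CoPH U3Letters₁₁
  U3Objects₁₁ NE2Objects₁₁ NE3Letters₁₁ prependCoupling MatA ιSU avOfRecord)
open Literature.MathematicalPhysics.QuantumFieldTheory.Balaban1983to89.Node00.Sect2 (domCount domSys CPair ofBackgroundC)
open Literature.MathematicalPhysics.QuantumFieldTheory.Balaban1983to89.Node00.W1 (ReadingData LevelPairing LetterInputs ClusterTower pairOfRecord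
  dj_pairOfRecord functionalC functional box SpRestr)
open Summit.QuantumFields.BalabanUV.T4Continuum.B13Carriers (transportRaw)
open Summit.QuantumFields.BalabanUV.T4Continuum.Spine.NE5
open YMDAG.N18.HLayer
open YMDAG.UVSplit

variable {N : ℕ} [NeZero N]

/-! ## §1 The regime-restricted Stage-13 home for a reading pinned to W1 reading data -/

section PinnedOn

variable (𝔯 : RateReading₁₃CoPH N) (Rg : (F : T4Family) → Stage13HParams F N → Prop)
  (W : (F : T4Family) → (θ : Stage13HParams F N) → ReadingData F (MatA N) θ.τ9.M)
  (hpin : ∀ (F : T4Family) (θ : Stage13HParams F N) (hP : θ.Provisos₁₃CoPH F N) (g₀ : ℕ → ℝ) (os : List (ULoop F)),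
    (𝔯.lit F θ hP g₀ os).u3 = (W F θ).u3Objects θ.γ)

include hpin in
/-- ★ **N18 AT THE REGIME-RESTRICTED STAGE-13 HOME, CLOSED FORM, ANY PINNED READING** [bookkeeping; layer B's guarded θ-form `s_N18_rRec₁₃CoPHOn_iff` + `hpin` + module 18 §1's
`Iff.rfl` face]: `S_N18 (RRec₁₃CoPHOn 𝔯 Rg)` ⇔ for every family `F`, every Stage-13 tuple `θ` with provisos IN THE REGIME (`Rg F θ`) and admissible, every run length `k`,
member `b ∈ ]0, θ.γ]`, history `g ∈ ]0, θ.γ]^ℕ`, run-B background `U` and run-A domain `(j, X)`: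
`|Re E_A^{(j)}(X; g; embA (transport U)) − Re E_B(pair (j, X); b∷g; embB U)| ≤ C₅ · θ₅ ^ j · e^{−κ·d_j(X)}` for the objects of `W F θ`.  NOT PRINTED; NOT proved.
[cite: Balaban1987RG1, Thm 1 p.259 and (1.18) p.263; Balaban1988RG2Cluster, (2.13) p.14] -/
theorem s_N18_rRec₁₃CoPHOn_iff_of_pin :
    S_N18 (RRec₁₃CoPHOn 𝔯 Rg) ↔
      ∀ (F : T4Family) (θ : Stage13HParams F N), θ.Provisos₁₃CoPH F N → Rg F θ → θ.Admissible F N → ∀ (k : ℕ) (b : ℝ), 0 < b → b ≤ θ.γ →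
        ∀ g ∈ Window θ.γ, ∀ (U : ((W F θ).pairing k).BgB) (X : Node00.W1.Dom (F.P k) θ.τ9.M),
          |(functionalC ((W F θ).S k) g (((W F θ).pairing k).embA (((W F θ).pairing k).transport U)) X).re -
              (functionalC ((W F θ).S (k + 1)) (prependCoupling b g) (((W F θ).pairing k).embB U) (((W F θ).pairing k).pair X)).re| ≤
            (W F θ).li.C₅ * (W F θ).li.θ₅ ^ X.1 * Real.exp (-((W F θ).li.κ * (domSys (F.P k) θ.τ9.M X.1).dj X.2)) := by
  rw [s_N18_rRec₁₃CoPHOn_iff]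
  constructor
  · intro H F θ hP hRg hA k
    have h₁ := H F θ hP hRg hA (fun _ => 0) [] k
    rw [hpin] at h₁
    exact h₁
  · intro H F θ hP hRg hA g₀ os k
    rw [hpin]
    exact H F θ hP hRg hA k

end PinnedOn

section AdmOn

variable (𝔯 : RateReading₁₃CoPH N) (Rg : (F : T4Family) → Stage13HParams F N → Prop)
  (S : (F : T4Family) → (θ : Stage13HParams F N) → (k : ℕ) → ClusterTower (F.P k) (MatA N) θ.τ9.M)
  (sp : (F : T4Family) → (θ : Stage13HParams F N) → (k j : ℕ) → (domSys (F.P k) θ.τ9.M j).Dom → Set (CPair (F.P k) (MatA N)))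
  (gauge : (F : T4Family) → (θ : Stage13HParams F N) → (k : ℕ) → GaugeField (F.P k) 0 (Node00.SU N) → GaugeField (F.P k) 0 (Node00.SU N) → ℝ)
  (hg : ∀ (F : T4Family) (θ : Stage13HParams F N) (k : ℕ) (U U' : GaugeField (F.P k) 0 (Node00.SU N)), 0 ≤ gauge F θ k U U')
  (T₀ : (F : T4Family) → (θ : Stage13HParams F N) → (k : ℕ) → GaugeField (F.P (k + 1)) 0 (Node00.SU N) → GaugeField (F.P k) 0 (Node00.SU N))
  (hT : ∀ (F : T4Family) (θ : Stage13HParams F N) (k : ℕ) (U : GaugeField (F.P (k + 1)) 0 (Node00.SU N)),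
    (∀ (j : ℕ) (Y : (domSys (F.P (k + 1)) θ.τ9.M j).Dom), ofBackgroundC (ιSU N) U ∈ sp F θ (k + 1) j Y) →
      ∀ (j : ℕ) (X : (domSys (F.P k) θ.τ9.M j).Dom), ofBackgroundC (ιSU N) (T₀ F θ k U) ∈ sp F θ k j X)
  (li : (F : T4Family) → Stage13HParams F N → LetterInputs)
  (hpin : ∀ (F : T4Family) (θ : Stage13HParams F N) (hP : θ.Provisos₁₃CoPH F N) (g₀ : ℕ → ℝ) (os : List (ULoop F)),
    (𝔯.lit F θ hP g₀ os).u3 =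
      (ReadingData.ofRecordAdm F θ.τ9.M N (S F θ) (sp F θ) (gauge F θ) (hg F θ) (T₀ F θ) (hT F θ) (li F θ)).u3Objects θ.γ)

include hpin in
open Classical in
/-- ★ **THE JUNCTION ROW AT THE REGIME-RESTRICTED HOME — THE DATA ASKED ONLY OF THE TUPLES IN THE REGIME** [bookkeeping; layer B's `s_N18_rRec₁₃CoPHOn_iff` + `hpin` + module 18
§1's per-tuple junction `n18At_u3OfRecord₁₃_readingAdm_of_envelope_bound238`]: for a reading pinned to the ADMISSIBLE reading family (towers `S F θ`, tables `sp F θ`,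
transports `T₀ F θ` with clause `hT`, letters `li F θ`, indexed by the Stage-13 tuples): if at EVERY admissible Stage-13 tuple `θ` with `Provisos₁₃CoPH` IN THE REGIME `Rg F θ`
and every run length `k` there are (i) the END's data over the carriers of the admissible level pairing (step models representing (2.13) with THE NODE-A MAJORANT AS
HYPOTHESIS, L01–L03, L07 ∕ L08, W3 shapes, numerals, L10, sharp clause) and (ii) restriction-closedness, `AnalyticH` + `Bound238` of `S F θ k ∕ (k+1)` ON THE TABLES
`sp F θ k ∕ (k+1)` with STRICT [KP86] clauses, letters dominating — then `S_N18 (RRec₁₃CoPHOn 𝔯 Rg)`.  At `Rg F θ := θ.ZhUnity F N ∧ θ.SlotsNondegenerate₁₃ F N` this is the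
guarded binder prefix of rev 16 ∕ 17. [cite: Balaban1988RG2Cluster, (2.13) p.14, (2.16)–(2.18) p.16 and Lemma 3 (2.38) p.20; Balaban1987RG1, (0.24)–(0.25) p.257, (1.18) p.263 and Thm 1 p.259] -/
theorem s_N18_rRec₁₃CoPHOn_readingAdm_of_envelope_bound238_pin
    (h : ∀ (F : T4Family) (θ : Stage13HParams F N), θ.Provisos₁₃CoPH F N → Rg F θ → θ.Admissible F N → ∀ k : ℕ,
      ∃ (Op : Type) (_ : NormedAddCommGroup Op) (_ : NormedSpace ℂ Op) (Hist : Type) (_ : NormedAddCommGroup Hist) (_ : NormedSpace ℂ Hist)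
        (Mb : ℝ → StepModel (LevelPairing.ofRecordAdm F θ.τ9.M N k (sp F θ) (gauge F θ k) (hg F θ k) (T₀ F θ k) (hT F θ k)).carriers Op Hist)
        (act : ℝ → (j : ℕ) → Op × Hist → TDom 4 (domCount (F.P k) θ.τ9.M j) → ℂ) (γ' C3 ε₁ Rd κ A_A A_B E₁ δ δ' θr θ' cH ω ρ₀ B : ℝ) (k₀ : ℕ),
        -- (i) the END's data over the carriers of the admissible level pairing
        (∀ b : ℝ, 0 < b → b ≤ γ' → ∀ (X : Node00.W1.Dom (F.P k) θ.τ9.M) (z : Op × Hist),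
          (Mb b).Out X.1 z.1 z.2 X =
            locE (TTouch (d := 4) (N := domCount (F.P k) θ.τ9.M X.1)) (fun Z : (tsys 4 (domCount (F.P k) θ.τ9.M X.1)).Dom => Z.1)
              (act b X.1 z) X.2.1) ∧
        0 ≤ C3 ∧ 0 ≤ ε₁ ∧ 0 ≤ κ ∧ κ + 2 * (64 * Real.log 162) + 2 ≤ Rd ∧
        C3 * ε₁ * Real.exp (5 * κ + 1) * K₀ 64 8 * 9 * 64 ≤ 1 ∧
        (∀ b : ℝ, 0 < b → b ≤ γ' → ∀ j, ∀ g ∈ Window γ',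
          ∀ (U : (LevelPairing.ofRecordAdm F θ.τ9.M N k (sp F θ) (gauge F θ k) (hg F θ k) (T₀ F θ k) (hT F θ k)).BgB) (q : Op × Hist),
          q ∈ (Mb b).Base j g U →
          ∃ V : Set (Op × Hist), IsOpen V ∧ (Mb b).box j q ⊆ V ∧
            (∀ Z : TDom 4 (domCount (F.P k) θ.τ9.M j), DifferentiableOn ℂ (fun z : Op × Hist => act b j z Z) V) ∧
            (∀ z ∈ V, ∀ Z : TDom 4 (domCount (F.P k) θ.τ9.M j), ‖act b j z Z‖ ≤ C3 * ε₁ * Real.exp (-(Rd * torusTreeLen Z.1)))) ∧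
        (∀ b : ℝ, 0 < b → b ≤ γ' → L01 (Mb b)
          ((LevelPairing.ofRecordAdm F θ.τ9.M N k (sp F θ) (gauge F θ k) (hg F θ k) (T₀ F θ k) (hT F θ k)).EA (S F θ k)) (Window γ')) ∧
        (∀ b : ℝ, 0 < b → b ≤ γ' → L02 (Mb b)
          ((LevelPairing.ofRecordAdm F θ.τ9.M N k (sp F θ) (gauge F θ k) (hg F θ k) (T₀ F θ k) (hT F θ k)).EB (S F θ (k + 1)) b)
          (Window γ')) ∧
        (∀ b : ℝ, 0 < b → b ≤ γ' → L03 (Mb b)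
          ((LevelPairing.ofRecordAdm F θ.τ9.M N k (sp F θ) (gauge F θ k) (hg F θ k) (T₀ F θ k) (hT F θ k)).EB (S F θ (k + 1)) b)
          (Window γ')) ∧
        (∀ b : ℝ, 0 < b → b ≤ γ' → L07 (Mb b) (Window γ') δ θr) ∧
        (∀ b : ℝ, 0 < b → b ≤ γ' → L08 (Mb b) (Window γ') κ (Real.exp 1 * 9 * 64 * K₀ 64 8 ^ 2 * A_B) δ' θr) ∧
        (∀ b : ℝ, 0 < b → b ≤ γ' → L09aff (Mb b) (Window γ')) ∧ (∀ b : ℝ, 0 < b → b ≤ γ' → L09blind (Mb b) (Window γ')) ∧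
        (∀ b : ℝ, 0 < b → b ≤ γ' → L09hom (Mb b) (Window γ')) ∧ (∀ b : ℝ, 0 < b → b ≤ γ' → L09unit (Mb b) (Window γ') κ E₁ cH ω) ∧
        0 < E₁ ∧ 0 ≤ δ + δ' ∧ 0 ≤ θr ∧ θr ≤ θ' ∧ θ' ≤ 1 ∧ 0 ≤ cH ∧ 0 < ω ∧ ρ₀ < 1 ∧
        (δ + δ') * θr ^ k₀ +
            cH * (Real.exp 1 * 9 * 64 * K₀ 64 8 ^ 2 * A_A + Real.exp 1 * 9 * 64 * K₀ 64 8 ^ 2 * A_B) / (1 - ω) ≤ ρ₀ ∧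
        0 ≤ B ∧ (∀ k < k₀, Real.exp 1 * 9 * 64 * K₀ 64 8 ^ 2 * A_A + Real.exp 1 * 9 * 64 * K₀ 64 8 ^ 2 * A_B ≤ B * θr ^ k) ∧
        Real.exp 1 * 9 * 64 * K₀ 64 8 ^ 2 * C3 * cH * ε₁ < (θ' - ω) * (1 - ρ₀) ∧
        -- (ii) the towers' H-layer data in the configuration direction ON THE TABLES, both runs
        (∀ m, SpRestr (sp F θ k (m + 1))) ∧
        (∀ m, (S F θ k m).AnalyticH (box γ' m) (sp F θ k (m + 1))) ∧ (∀ m, (S F θ k m).Bound238 (box γ' m) (sp F θ k (m + 1)) A_A Rd) ∧ 0 ≤ A_A ∧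
        A_A * Real.exp (5 * κ + 1) * K₀ 64 8 * 9 * 64 < 1 ∧
        (∀ m, SpRestr (sp F θ (k + 1) (m + 1))) ∧
        (∀ m, (S F θ (k + 1) m).AnalyticH (box γ' m) (sp F θ (k + 1) (m + 1))) ∧
        (∀ m, (S F θ (k + 1) m).Bound238 (box γ' m) (sp F θ (k + 1) (m + 1)) A_B Rd) ∧
        0 ≤ A_B ∧ A_B * Real.exp (5 * κ + 1) * K₀ 64 8 * 9 * 64 < 1 ∧
        -- the reading's letters dominate the END's
        θ.γ ≤ γ' ∧ (li F θ).κ ≤ κ ∧ θ' ≤ (li F θ).θ₅ ∧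
        (Real.exp 1 * 9 * 64 * K₀ 64 8 ^ 2 * (C3 * ε₁) / (1 - ρ₀) * (δ + δ') + B) * (θ' - ω) /
            (θ' - (ω + Real.exp 1 * 9 * 64 * K₀ 64 8 ^ 2 * (C3 * ε₁) / (1 - ρ₀) * cH)) ≤ (li F θ).C₅) :
    S_N18 (RRec₁₃CoPHOn 𝔯 Rg) := by
  rw [s_N18_rRec₁₃CoPHOn_iff]
  intro F θ hP hRg hA g₀ os k
  rw [hpin]
  exact n18At_u3OfRecord₁₃_readingAdm_of_envelope_bound238 θ.toStage13Params k (S F θ) (sp F θ) (gauge F θ) (hg F θ) (T₀ F θ) (hT F θ) (li F θ) (h F θ hP hRg hA k)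

end AdmOn

/-! ## §2 At the (T-RATE) reading of record `readingOfRecord₁₃CoPH` (pin `rfl`) -/

section OfRecord

variable (w1 : (F : T4Family) → (θ : Stage13HParams F N) → ReadingData F (MatA N) θ.τ9.M) (ℓ₃ : T4Family → NE3Letters₁₁)
  (ne2 : (F : T4Family) → Stage13HParams F N → (ℕ → ℝ) → List (ULoop F) → ℕ → NE2Objects₁₁)
  (ne1 : (F : T4Family) → Stage13HParams F N → (ℕ → ℝ) → List (ULoop F) → NE1pCarriers)

/-- ★ **N18's STATEMENT AT THE READING OF RECORD, STAGE 13, IN W1's CURRENCY** [bookkeeping; module 18 §2 `s_N18_rRec₁₃CoPH_iff_of_pin` at `hpin := readingOfRecord₁₃CoPH_u3` (`rfl`)]: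
`S_N18 (RRec₁₃CoPH (readingOfRecord₁₃CoPH w1 ℓ₃ ne2 ne1))` ⇔ for every family `F`, Stage-13 datum key `h` (`θ := h.params`), run length `k`, member `b ∈ ]0, θ.γ]`, history
`g ∈ ]0, θ.γ]^ℕ`, run-B background `U` and run-A domain `(j, X)` of W1's reading data `w1 F θ`:
`|Re E_A^{(j)}(X; g; embA (transport U)) − Re E_B(pair (j, X); b∷g; embB U)| ≤ C₅ · θ₅ ^ j · e^{−κ·d_j(X)}`.  N16's letters `ℓ₃`, N15's layers `ne2`, NODE O's `ne1` are
NOT read.  NOT PRINTED; NOT proved; content exactly for reading data pinned to the (2.14) terms. [cite: Balaban1987RG1, Thm 1 p.259 and (1.18) p.263; Balaban1988RG2Cluster, (2.13) p.14] -/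
theorem s_N18_readingOfRecord₁₃CoPH_iff_w1 :
    S_N18 (RRec₁₃CoPH (readingOfRecord₁₃CoPH w1 ℓ₃ ne2 ne1)) ↔
      ∀ (F : T4Family) (D : Datum F N) (h : IsDatumOfRecord₁₃CCoPH F N D) (k : ℕ) (b : ℝ), 0 < b → b ≤ h.params.γ →
        ∀ g ∈ Window h.params.γ, ∀ (U : ((w1 F h.params).pairing k).BgB) (X : Node00.W1.Dom (F.P k) h.params.τ9.M),
          |(functionalC ((w1 F h.params).S k) g (((w1 F h.params).pairing k).embA (((w1 F h.params).pairing k).transport U)) X).re -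
              (functionalC ((w1 F h.params).S (k + 1)) (prependCoupling b g) (((w1 F h.params).pairing k).embB U)
                (((w1 F h.params).pairing k).pair X)).re| ≤
            (w1 F h.params).li.C₅ * (w1 F h.params).li.θ₅ ^ X.1 *
              Real.exp (-((w1 F h.params).li.κ * (domSys (F.P k) h.params.τ9.M X.1).dj X.2)) :=
  s_N18_rRec₁₃CoPH_iff_of_pin _ w1 (readingOfRecord₁₃CoPH_u3 w1 ℓ₃ ne2 ne1)

/-- **THE SAME AT THE REGIME-RESTRICTED HOME OF THE READING OF RECORD** [bookkeeping; §1 at the `rfl` pin]. [cite: Balaban1987RG1, Thm 1 p.259 and (1.18) p.263] -/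
theorem s_N18_readingOfRecord₁₃CoPHOn_iff_w1 (Rg : (F : T4Family) → Stage13HParams F N → Prop) :
    S_N18 (RRec₁₃CoPHOn (readingOfRecord₁₃CoPH w1 ℓ₃ ne2 ne1) Rg) ↔
      ∀ (F : T4Family) (θ : Stage13HParams F N), θ.Provisos₁₃CoPH F N → Rg F θ → θ.Admissible F N → ∀ (k : ℕ) (b : ℝ), 0 < b → b ≤ θ.γ →
        ∀ g ∈ Window θ.γ, ∀ (U : ((w1 F θ).pairing k).BgB) (X : Node00.W1.Dom (F.P k) θ.τ9.M),
          |(functionalC ((w1 F θ).S k) g (((w1 F θ).pairing k).embA (((w1 F θ).pairing k).transport U)) X).re -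
              (functionalC ((w1 F θ).S (k + 1)) (prependCoupling b g) (((w1 F θ).pairing k).embB U) (((w1 F θ).pairing k).pair X)).re| ≤
            (w1 F θ).li.C₅ * (w1 F θ).li.θ₅ ^ X.1 * Real.exp (-((w1 F θ).li.κ * (domSys (F.P k) θ.τ9.M X.1).dj X.2)) :=
  s_N18_rRec₁₃CoPHOn_iff_of_pin _ Rg w1 (readingOfRecord₁₃CoPH_u3 w1 ℓ₃ ne2 ne1)

end OfRecord

section OfRecordAdm

variable (S : (F : T4Family) → (θ : Stage13HParams F N) → (k : ℕ) → ClusterTower (F.P k) (MatA N) θ.τ9.M)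
  (sp : (F : T4Family) → (θ : Stage13HParams F N) → (k j : ℕ) → (domSys (F.P k) θ.τ9.M j).Dom → Set (CPair (F.P k) (MatA N)))
  (gauge : (F : T4Family) → (θ : Stage13HParams F N) → (k : ℕ) → GaugeField (F.P k) 0 (Node00.SU N) → GaugeField (F.P k) 0 (Node00.SU N) → ℝ)
  (hg : ∀ (F : T4Family) (θ : Stage13HParams F N) (k : ℕ) (U U' : GaugeField (F.P k) 0 (Node00.SU N)), 0 ≤ gauge F θ k U U')
  (T₀ : (F : T4Family) → (θ : Stage13HParams F N) → (k : ℕ) → GaugeField (F.P (k + 1)) 0 (Node00.SU N) → GaugeField (F.P k) 0 (Node00.SU N))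
  (hT : ∀ (F : T4Family) (θ : Stage13HParams F N) (k : ℕ) (U : GaugeField (F.P (k + 1)) 0 (Node00.SU N)),
    (∀ (j : ℕ) (Y : (domSys (F.P (k + 1)) θ.τ9.M j).Dom), ofBackgroundC (ιSU N) U ∈ sp F θ (k + 1) j Y) →
      ∀ (j : ℕ) (X : (domSys (F.P k) θ.τ9.M j).Dom), ofBackgroundC (ιSU N) (T₀ F θ k U) ∈ sp F θ k j X)
  (li : (F : T4Family) → Stage13HParams F N → LetterInputs) (ℓ₃ : T4Family → NE3Letters₁₁)
  (ne2 : (F : T4Family) → Stage13HParams F N → (ℕ → ℝ) → List (ULoop F) → ℕ → NE2Objects₁₁)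
  (ne1 : (F : T4Family) → Stage13HParams F N → (ℕ → ℝ) → List (ULoop F) → NE1pCarriers)

/-- ★ **N18's STATEMENT AT THE READING OF RECORD WITH THE ADMISSIBLE READING DATA, STAGE 13, CLOSED FORM** [bookkeeping; module 18 §3 `s_N18_rRec₁₃CoPH_readingAdm_iff_of_pin`
at the `rfl` pin]: with `w1 F θ := ReadingData.ofRecordAdm F θ.τ9.M N (S F θ) (sp F θ) (gauge F θ) (hg F θ) (T₀ F θ) (hT F θ) (li F θ)`, `S_N18 (RRec₁₃CoPH (readingOfRecord₁₃CoPH w1 ℓ₃ ne2 ne1))`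
⇔ for every family `F`, Stage-13 datum key `h` (`θ := h.params`), run length `k`, member `b ∈ ]0, θ.γ]`, history `g ∈ ]0, θ.γ]^ℕ`, every ADMISSIBLE run-B gauge field `U`
of the `(k+1)`-th torus (read inside `sp F θ (k+1)`) and run-A domain `(j, X)`:
`|Re E^{(j)}_{S_k}(X; g; (ι(T₀ U), 0)) − Re E^{(j+1)}_{S_{k+1}}(πX; b∷g; (ιU, 0))| ≤ C₅ · θ₅ ^ j · e^{−κ·d_j(X)}`.  The rows for this reading are module 18 §3
`s_N18_rRec₁₃CoPH_readingAdm_of_envelope_bound238_pin` and §1 `s_N18_rRec₁₃CoPHOn_readingAdm_of_envelope_bound238_pin` at `hpin := readingOfRecord₁₃CoPH_u3 …` (one line).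
NOT PRINTED; NOT proved. [cite: Balaban1987RG1, Thm 1 p.259, (1.11)–(1.16) p.262 and (1.18) p.263; Balaban1988RG2Cluster, (2.13) p.14 and (2.16)–(2.18) p.16] -/
theorem s_N18_readingOfRecord₁₃CoPH_readingAdm_iff :
    S_N18 (RRec₁₃CoPH (readingOfRecord₁₃CoPH (fun F θ => ReadingData.ofRecordAdm F θ.τ9.M N (S F θ) (sp F θ) (gauge F θ) (hg F θ) (T₀ F θ) (hT F θ) (li F θ))
      ℓ₃ ne2 ne1)) ↔
      ∀ (F : T4Family) (D : Datum F N) (h : IsDatumOfRecord₁₃CCoPH F N D) (k : ℕ) (b : ℝ), 0 < b → b ≤ h.params.γ →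
        ∀ g ∈ Window h.params.γ,
          ∀ (U : {U : GaugeField (F.P (k + 1)) 0 (Node00.SU N) //
              ∀ (j : ℕ) (Y : (domSys (F.P (k + 1)) h.params.τ9.M j).Dom), ofBackgroundC (ιSU N) U ∈ sp F h.params (k + 1) j Y})
            (X : Node00.W1.Dom (F.P k) h.params.τ9.M),
          |(functionalC (S F h.params k) g (ofBackgroundC (ιSU N) (T₀ F h.params k U.1)) X).re -
              (functionalC (S F h.params (k + 1)) (prependCoupling b g) (ofBackgroundC (ιSU N) U.1) (pairOfRecord F h.params.τ9.M k X)).re| ≤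
            (li F h.params).C₅ * (li F h.params).θ₅ ^ X.1 * Real.exp (-((li F h.params).κ * (domSys (F.P k) h.params.τ9.M X.1).dj X.2)) :=
  s_N18_rRec₁₃CoPH_readingAdm_iff_of_pin _ S sp gauge hg T₀ hT li
    (readingOfRecord₁₃CoPH_u3 (fun F θ => ReadingData.ofRecordAdm F θ.τ9.M N (S F θ) (sp F θ) (gauge F θ) (hg F θ) (T₀ F θ) (hT F θ) (li F θ)) ℓ₃ ne2 ne1)

end OfRecordAdm

end YMDAG.N18.W1Reading

end
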